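import Literature.AlgebraicGeometry.Smoothening.GenericSmoothness
import Literature.AlgebraicGeometry.Smoothening.DilatationDefect
import Mathlib.RingTheory.Polynomial.Basic
import Mathlib.RingTheory.Ideal.MinimalPrime.Localization
import HarnessLib

/-!
# Reduction of the centre modulo `ϖ` (affine forest bookkeeping, BLR 3.4)

Topic: `Literature/AlgebraicGeometry/Smoothening` (Bosch–Lütkebohmert–Raynaud, *Néron Models*,
§3.3 Lemma 4 and §3.4). The centre `Y` of a smoothening step lives in the special fibre: its
ideal `𝔶̃ ⊆ B = R[T₁, …, T_N]` contains `ϖ`, and its image `𝔞 ⊆ k[T₁, …, T_N]` under the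
reduction map `red` (`MvPolynomial.map π₀` for a surjection `π₀ : R → k` with kernel `(ϖ)`,
e.g. the residue map of a discrete valuation ring) is the ideal to which `GenericSmoothness`
applies. The residue ring `k` is kept abstract (rather than `R ⧸ (ϖ)`) so that the smoothening
theorem can be applied with the residue *field* instance of a local ring. This file transfers
the field-level data back to `B`:

* `red`, `red_surjective`, `ker_red` (`= (ϖ)`), `mem_of_red_mem`, `isRadical_map_red`,
  `map_red_ne_top`;
* `exists_lift` — lifting tuples along `red`; `red_jacobianDet` — the Jacobian minor of lifts
  reduces to the Jacobian minor;
* the inclusions feeding `ForestStep`/`ChartCentre` from the conclusions of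
  `exists_smooth_chart_of_mem_minimalPrimes`: `mul_mem_centreIdealB_of_red` (`ĥ·𝔶̃ ⊆ (ϖ, g)`),
  `mul_mem_of_red` (`ĥ·(ϖ, g) ⊆ 𝔶̃`), `not_mem_comap_of_red` (`ĥ ∉ 𝔫̃ = red⁻¹ 𝔫̄`);
* `map_mk_comap_mem_minimalPrimes` — the minimal prime of `B/𝔶̃` corresponding to a minimal
  prime `𝔫̄` of `𝔞` (for `GenericFreeness`).

[folklore]; no named facts (D-0026).

## References

* S. Bosch, W. Lütkebohmert, M. Raynaud, *Néron Models*, Springer 1990, §3.3 Lemma 4, §3.4.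
  [BLRNeronModels1990] (Not held; numbers only.)
-/

noncomputable section

open MvPolynomial

namespace Literature.AlgebraicGeometry.Smoothening

universe u

variable {R : Type u} [CommRing R] {k : Type u} [CommRing k] (π₀ : R →+* k) (N : ℕ)

/-- **The reduction map** `B = R[T₁, …, T_N] → k[T₁, …, T_N]` induced by `π₀ : R → k`.
[folklore] -/
def red : MvPolynomial (Fin N) R →+* MvPolynomial (Fin N) k :=
  MvPolynomial.map π₀

/-- `red (C c) = C (π₀ c)`. [folklore] -/
@[simp]
theorem red_C (c : R) : red π₀ N (C c) = C (π₀ c) := map_C _ c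

/-- `red Tᵢ = Tᵢ`. [folklore] -/
@[simp]
theorem red_X (i : Fin N) : red π₀ N (X i) = X i := map_X _ i

variable {π₀}

/-- The reduction map is surjective when `π₀` is. [folklore] -/
theorem red_surjective (hπ₀ : Function.Surjective π₀) : Function.Surjective (red π₀ N) :=
  map_surjective _ hπ₀

variable {N} {ϖ : R}

/-- **The kernel of the reduction map is `(ϖ)`** when `ker π₀ = (ϖ)`. [folklore] -/
theorem ker_red (hker : RingHom.ker π₀ = Ideal.span {ϖ}) :
    RingHom.ker (red π₀ N) = Ideal.span {(C ϖ : MvPolynomial (Fin N) R)} := by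
  rw [red, MvPolynomial.ker_map, hker, Ideal.map_span, Set.image_singleton]

/-- `C ϖ` dies under reduction. [folklore] -/
theorem red_C_self (hker : RingHom.ker π₀ = Ideal.span {ϖ}) : red π₀ N (C ϖ) = 0 := by
  rw [← RingHom.mem_ker, ker_red hker]
  exact Ideal.mem_span_singleton_self _

/-- An ideal containing `ϖ` is the preimage of its reduction. [folklore] -/
theorem comap_map_red (hπ₀ : Function.Surjective π₀) (hker : RingHom.ker π₀ = Ideal.span {ϖ})
    {𝔶 : Ideal (MvPolynomial (Fin N) R)} (hϖ : C ϖ ∈ 𝔶) :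
    (𝔶.map (red π₀ N)).comap (red π₀ N) = 𝔶 := by
  rw [Ideal.comap_map_of_surjective _ (red_surjective N hπ₀), ← RingHom.ker_eq_comap_bot,
    ker_red hker, sup_eq_left]
  exact (Ideal.span_singleton_le_iff_mem _).mpr hϖ

/-- If `red x ∈ red 𝔶̃` and `ϖ ∈ 𝔶̃` then `x ∈ 𝔶̃`. [folklore] -/
theorem mem_of_red_mem (hπ₀ : Function.Surjective π₀) (hker : RingHom.ker π₀ = Ideal.span {ϖ})
    {𝔶 : Ideal (MvPolynomial (Fin N) R)} (hϖ : C ϖ ∈ 𝔶)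
    {x : MvPolynomial (Fin N) R} (hx : red π₀ N x ∈ 𝔶.map (red π₀ N)) : x ∈ 𝔶 := by
  rw [← comap_map_red hπ₀ hker hϖ]
  exact Ideal.mem_comap.mpr hx

/-- The reduction of a radical ideal containing `ϖ` is radical. [folklore] -/
theorem isRadical_map_red (hπ₀ : Function.Surjective π₀) (hker : RingHom.ker π₀ = Ideal.span {ϖ})
    {𝔶 : Ideal (MvPolynomial (Fin N) R)} (hϖ : C ϖ ∈ 𝔶) (h𝔶 : 𝔶.IsRadical) :
    (𝔶.map (red π₀ N)).IsRadical := by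
  intro z ⟨n, hn⟩
  obtain ⟨x, rfl⟩ := red_surjective N hπ₀ z
  rw [← map_pow] at hn
  exact Ideal.mem_map_of_mem _ (h𝔶 ⟨n, mem_of_red_mem hπ₀ hker hϖ hn⟩)

/-- The reduction of a proper ideal containing `ϖ` is proper. [folklore] -/
theorem map_red_ne_top (hπ₀ : Function.Surjective π₀) (hker : RingHom.ker π₀ = Ideal.span {ϖ})
    {𝔶 : Ideal (MvPolynomial (Fin N) R)} (hϖ : C ϖ ∈ 𝔶) (h𝔶 : 𝔶 ≠ ⊤) :
    𝔶.map (red π₀ N) ≠ ⊤ := fun htop =>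
  h𝔶 ((Ideal.eq_top_iff_one _).mpr (mem_of_red_mem hπ₀ hker hϖ (by rw [htop]; trivial)))

variable (N)

/-- **Lifting tuples along the reduction map.** [folklore] -/
theorem exists_lift (hπ₀ : Function.Surjective π₀) {r : ℕ}
    (gbar : Fin r → MvPolynomial (Fin N) k) :
    ∃ g : Fin r → MvPolynomial (Fin N) R, ∀ j, red π₀ N (g j) = gbar j :=
  ⟨fun j => (red_surjective N hπ₀ (gbar j)).choose,
    fun j => (red_surjective N hπ₀ (gbar j)).choose_spec⟩

variable (π₀)

/-- **The Jacobian minor of lifts reduces to the Jacobian minor.** [folklore] -/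
theorem red_jacobianDet {r : ℕ} (g : Fin r → MvPolynomial (Fin N) R) (a : Fin r → Fin N) :
    red π₀ N (jacobianDet g a) = jacobianDet (fun j => red π₀ N (g j)) a :=
  map_jacobianDet g a _

variable {π₀ N}

/-! ### The inclusions at the level of `B` -/

section Inclusions

variable {r : ℕ} {𝔶 : Ideal (MvPolynomial (Fin N) R)}
  {g : Fin r → MvPolynomial (Fin N) R} {ĥ : MvPolynomial (Fin N) R}
  {𝔫 : Ideal (MvPolynomial (Fin N) k)}

/-- **`ĥ·𝔶̃ ⊆ (ϖ, g)`** from `h̄·𝔫̄ ⊆ (gbar)` and `red 𝔶̃ ⊆ 𝔫̄` (any multiple of `ĥ` works as well).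
[folklore] -/
theorem mul_mem_centreIdealB_of_red (hπ₀ : Function.Surjective π₀)
    (hker : RingHom.ker π₀ = Ideal.span {ϖ}) (h𝔞𝔫 : 𝔶.map (red π₀ N) ≤ 𝔫)
    (hh𝔫 : ∀ x ∈ 𝔫, red π₀ N ĥ * x ∈ Ideal.span (Set.range fun j => red π₀ N (g j)))
    (t : MvPolynomial (Fin N) R) {y : MvPolynomial (Fin N) R} (hy : y ∈ 𝔶) :
    t * ĥ * y ∈ centreIdealB ϖ g := by
  have h1 : red π₀ N (ĥ * y) ∈ (Ideal.span (Set.range g)).map (red π₀ N) := by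
    rw [Ideal.map_span, ← Set.range_comp, map_mul]
    exact hh𝔫 _ (h𝔞𝔫 (Ideal.mem_map_of_mem _ hy))
  rw [← Ideal.mem_comap, Ideal.comap_map_of_surjective _ (red_surjective N hπ₀),
    ← RingHom.ker_eq_comap_bot, ker_red hker] at h1
  rw [mul_assoc]
  refine Ideal.mul_mem_left _ t ?_
  have hle : Ideal.span (Set.range g) ⊔ Ideal.span {C ϖ} ≤ centreIdealB ϖ g := by
    refine sup_le (Ideal.span_mono (Set.subset_insert _ _)) ?_
    rw [Ideal.span_singleton_le_iff_mem]
    exact Ideal.subset_span (Set.mem_insert _ _)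
  exact hle h1

/-- **`ĥ·(ϖ, g) ⊆ 𝔶̃`** from `h̄·gbarⱼ ∈ 𝔞 = red 𝔶̃`. [folklore] -/
theorem mul_mem_of_red (hπ₀ : Function.Surjective π₀) (hker : RingHom.ker π₀ = Ideal.span {ϖ})
    (hϖ : C ϖ ∈ 𝔶) (hhg : ∀ j, red π₀ N ĥ * red π₀ N (g j) ∈ 𝔶.map (red π₀ N))
    (t : MvPolynomial (Fin N) R) {x : MvPolynomial (Fin N) R} (hx : x ∈ centreIdealB ϖ g) :
    t * ĥ * x ∈ 𝔶 := by
  rw [mul_assoc]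
  refine Ideal.mul_mem_left _ t ?_
  -- `x ↦ ĥ x ∈ 𝔶̃` on the generators of `(ϖ, g)`
  have key : ∀ z ∈ centreIdealB ϖ g, ĥ * z ∈ 𝔶 := by
    intro z hz
    refine Submodule.span_induction ?_ ?_ ?_ ?_ hz
    · rintro _ (rfl | ⟨j, rfl⟩)
      · rw [MvPolynomial.algebraMap_eq]
        exact Ideal.mul_mem_left _ _ hϖ
      · exact mem_of_red_mem hπ₀ hker hϖ (by rw [map_mul]; exact hhg j)
    · rw [mul_zero]; exact zero_mem _
    · intro x y _ _ hx hy
      rw [mul_add]; exact add_mem hx hy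
    · intro c x _ hx
      rw [smul_eq_mul, mul_left_comm]
      exact Ideal.mul_mem_left _ _ hx
  exact key x hx

/-- The preimage `𝔫̃ = red⁻¹ 𝔫̄` of a prime containing `𝔞 = red 𝔶̃` contains `𝔶̃`. [folklore] -/
theorem le_comap_of_red (hπ₀ : Function.Surjective π₀) (hker : RingHom.ker π₀ = Ideal.span {ϖ})
    (hϖ : C ϖ ∈ 𝔶) (h𝔞𝔫 : 𝔶.map (red π₀ N) ≤ 𝔫) : 𝔶 ≤ 𝔫.comap (red π₀ N) := by
  rw [← comap_map_red hπ₀ hker hϖ]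
  exact Ideal.comap_mono h𝔞𝔫

/-- An element whose reduction avoids `𝔫̄` avoids `𝔫̃ = red⁻¹ 𝔫̄`. [folklore] -/
theorem not_mem_comap_of_red {H : MvPolynomial (Fin N) R} (hH : red π₀ N H ∉ 𝔫) :
    H ∉ 𝔫.comap (red π₀ N) := fun hmem => hH (Ideal.mem_comap.mp hmem)

/-- **A point of the chart reduces into `V(gbar)`**: if `a` reduces into `V(𝔶̃)` and `a(ĥ)` is a
unit then `a(gⱼ) ∈ 𝔪` (`ĥ gⱼ ∈ 𝔶̃`). [folklore] -/
theorem apply_mem_maximalIdeal_of_red (hπ₀ : Function.Surjective π₀)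
    (hker : RingHom.ker π₀ = Ideal.span {ϖ}) (hϖ : C ϖ ∈ 𝔶)
    (hhg : ∀ j, red π₀ N ĥ * red π₀ N (g j) ∈ 𝔶.map (red π₀ N))
    {I : Ideal (MvPolynomial (Fin N) R)} {S : Type u} [CommRing S] [IsLocalRing S]
    (a : MvPolynomial (Fin N) R ⧸ I →+* S)
    (ha : ∀ y ∈ 𝔶, a (Ideal.Quotient.mk I y) ∈ IsLocalRing.maximalIdeal S)
    (hunit : IsUnit (a (Ideal.Quotient.mk I ĥ))) (j : Fin r) :
    a (Ideal.Quotient.mk I (g j)) ∈ IsLocalRing.maximalIdeal S := by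
  have h1 : a (Ideal.Quotient.mk I (1 * ĥ * g j)) ∈ IsLocalRing.maximalIdeal S :=
    ha _ (mul_mem_of_red hπ₀ hker hϖ hhg 1 (Ideal.subset_span (Set.mem_insert_of_mem _ ⟨j, rfl⟩)))
  rw [one_mul, map_mul, map_mul] at h1
  exact ((IsLocalRing.maximalIdeal.isMaximal S).isPrime.mem_or_mem h1).resolve_left
    fun hh => (IsLocalRing.mem_maximalIdeal _ |>.mp hh) hunit

end Inclusions

/-! ### Minimal primes -/

section MinimalPrimes

variable {𝔶 : Ideal (MvPolynomial (Fin N) R)} (hπ₀ : Function.Surjective π₀)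
  (hker : RingHom.ker π₀ = Ideal.span {ϖ}) (hϖ : C ϖ ∈ 𝔶)
  {𝔫 : Ideal (MvPolynomial (Fin N) k)}

include hπ₀ hker hϖ

/-- The preimage of a minimal prime of `𝔞 = red 𝔶̃` is a minimal prime of `𝔶̃`. [folklore] -/
theorem comap_mem_minimalPrimes (h𝔫 : 𝔫 ∈ (𝔶.map (red π₀ N)).minimalPrimes) :
    𝔫.comap (red π₀ N) ∈ 𝔶.minimalPrimes := by
  have h := Ideal.comap_minimalPrimes_eq_of_surjective (red_surjective N hπ₀)
    (I := 𝔶.map (red π₀ N))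
  rw [comap_map_red hπ₀ hker hϖ] at h
  rw [h]
  exact ⟨𝔫, h𝔫, rfl⟩

/-- **The minimal prime of `B/𝔶̃` attached to a minimal prime `𝔫̄` of `𝔞`**: the image of
`𝔫̃ = red⁻¹ 𝔫̄` in `B/𝔶̃` (for `GenericFreeness`). [folklore] -/
theorem map_mk_comap_mem_minimalPrimes (h𝔫 : 𝔫 ∈ (𝔶.map (red π₀ N)).minimalPrimes) :
    (𝔫.comap (red π₀ N)).map (Ideal.Quotient.mk 𝔶) ∈
      minimalPrimes (MvPolynomial (Fin N) R ⧸ 𝔶) := by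
  have h := Ideal.minimalPrimes_map_of_surjective (Ideal.Quotient.mk_surjective (I := 𝔶)) 𝔶
  rw [Ideal.mk_ker, sup_idem, Ideal.map_quotient_self] at h
  change _ ∈ Ideal.minimalPrimes ⊥
  rw [h]
  exact ⟨_, comap_mem_minimalPrimes hπ₀ hker hϖ h𝔫, rfl⟩

/-- Its preimage in `B` is `𝔫̃`. [folklore] -/
theorem comap_map_mk_comap (h𝔫 : 𝔫 ∈ (𝔶.map (red π₀ N)).minimalPrimes) :
    ((𝔫.comap (red π₀ N)).map (Ideal.Quotient.mk 𝔶)).comap (Ideal.Quotient.mk 𝔶) =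
      𝔫.comap (red π₀ N) := by
  rw [Ideal.comap_map_of_surjective _ Ideal.Quotient.mk_surjective, ← RingHom.ker_eq_comap_bot,
    Ideal.mk_ker, sup_eq_left]
  exact le_comap_of_red hπ₀ hker hϖ h𝔫.1.2

end MinimalPrimes

end Literature.AlgebraicGeometry.Smoothening

end
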